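import Summits.QuantumFields.YangMills.Theorems.BalabanUVNodesClustersCore
import Summits.QuantumFields.YangMills.Theorems.BalabanUVNodesN21ShellWeightKnit

/-!
# YM-DAG node N21 (= NE7c) AT THE SPINE CARRIERS: the K5 stub `YMDAG.UVSplit.S_N21 SRec` HOLDS for every carrier predicate
# `SRec` that reads its carriers `(S.l₀, S.T, S.A, S.B, S.shA, S.shB, S.Wsh)` off (0) two slot ledgers under a geometric
# majorant (road-agnostic), (I) a road-I package (two level ledgers + live windows + a geometric width) or (II) a road-II
# package (two age ledgers + a level gain) — `T4ShellMeasure.shellWeightBound_of_slotLedger` and file 1's knits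
# `n21_knit_levels` ∕ `n21_knit_ages_slot` BY NAME

Track A of `YM-PLAN.md` (cell `pub-ymgap`, HUMAN RULING D-0062), node **N21**; seat `pub-ymgap-dag-n21-a`, generation 4, file 8 (g3 staged it
against route module 1 v3; g4 files it against the LANDED part 1′ `BalabanUVNodesClustersCore` p416552, which declares `SpineCarriers`,
`SpineRecordPred` and `S_N21` — the joins of part 2 are not needed here).  Kernel bookkeeping BY NAME: 0 `def`, 0 `sorry`, standard axioms.
COUNT-NEUTRAL; `--supports` the K5 item `SpineGivenEndpoint`.

HONEST FRAMING.  NE7c is NOT PRINTED and NOT PROVED.  `S_N21 SRec` quantifies over the carriers OF RECORD that `SRec` pins (NODE 00 Stage 5 ∕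
NODE O — the predicate of record does not exist in the tree yet); this file says EXACTLY what a record predicate must supply for N21 to follow
from the tree's constructors: per string and tuned run, EITHER (0) two `T4ShellMeasure.SlotLedger`s at the carriers (per-slot pieces covering the
shell parts, per-slot relative bounds = (M1) `SlotAntiConcentration` on road I ∕ the realized fractions `SlotLedger.of_realized` on road (δ))
whose relative shell weights `ω^A`, `ω^B` lie under ONE geometric majorant `C·ϑ^K`, `0 ≤ ϑ < 1`; OR (I) road I's data (the two
`T4ShellMeasureLevels.LevelLedger`s — [dict] + (M1) per live slot —, the two `LiveWindow`s — N20 —, the constant bound `D ≤ D̄` — N12 —, a rate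
`0 < ϑ < 1`, `ρ_j ≤ c₁ϑ^j` — N16, produced in files 3∕6 as `(C_Q∕ε)θ^k` resp. `((C_Q + K)∕ε)θ^k`); OR (II) road II's data (`AgeLedger`s +
`LevelGain`); AND in every case a record weight slot `S.Wsh` that is summable and dominates the road's explicit weight (`shellWeightBound_mono`).
Nothing of Bałaban's is asserted; one finite four-torus at fixed `ε`; NOT continuum ∕ ℝ⁴ ∕ OS ∕ mass gap ∕ Clay.

WHAT IS PROVED ([folklore]).  `s_N21_of_slotLedgersReading` (road-agnostic), `s_N21_of_levelsReading` (road I), `s_N21_of_agesReading` (road II):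
`S_N21 SRec` for every `SRec` carrying the respective package (stated with `∃` over the auxiliary slot data, no new definition); and the glue
`s_N21_mono` (a predicate that REFINES a reading predicate inherits `S_N21`).
-/

set_option autoImplicit false

noncomputable section

open scoped BigOperators

namespace Summit.QuantumFields.YangMills.Theorems.N21AtSpineCarriers

open Literature.MathematicalPhysics.QuantumFieldTheory.Balaban1983to89
open T4IndicatorShell (ShellWeightBound)
open T4ShellMeasure (SlotLedger shellWeightBound_of_slotLedger)
open T4ShellMeasureLevels (LevelLedger LiveWindow)
open T4ShellCount (AgeLedger LevelGain)
open YMDAG.UVSplit (SpineCarriers SpineRecordPred S_N21)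
open Finset

/-- **GLUE: `S_N21` IS INHERITED BY REFINEMENT.**  If every carrier bundle pinned by `SRec'` is pinned by `SRec` (same datum, bare sequence,
string and carriers), then `S_N21 SRec → S_N21 SRec'` — the record predicate may carry MORE than a reading predicate. [folklore] -/
theorem s_N21_mono {N : ℕ} [NeZero N] {SRec SRec' : SpineRecordPred N}
    (himp : ∀ (F : T4Continuum.T4Family) (D : YMDAG.UVSplit.Datum F N) (g₀ : ℕ → ℝ)
      (os : List (T4Continuum.ULoop F)) (S : SpineCarriers), SRec' F D g₀ os S → SRec F D g₀ os S)
    (h : S_N21 SRec) : S_N21 SRec' :=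
  fun F D g₀ os S hS => h F D g₀ os S (himp F D g₀ os S hS)

/-- **`S_N21` FOR EVERY SLOT-LEDGER READING (road-agnostic).**  If the carrier predicate `SRec` hands, with every carrier bundle `S` it pins,
two `T4ShellMeasure.SlotLedger`s at `(S.l₀, S.T, S.A, S.shA)`, `(S.l₀, S.T, S.B, S.shB)` — slot types and data `(SA, pieceA, cA)`, `(SB, pieceB, cB)`:
shell parts `0 ≤ sh ≤` weight, covered by per-slot pieces, each slot's pieces `≤ c K s ×` the run total — whose relative shell weights
`ω^A K = Σ_s cA K s`, `ω^B K = Σ_s cB K s` lie under ONE geometric majorant `C·ϑ^K`, `0 ≤ ϑ < 1`, and `S.Wsh` summable with `ω^A + ω^B ≤ S.Wsh`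
— then `S_N21 SRec` (`T4ShellMeasure.shellWeightBound_of_slotLedger` + file 1's `shellWeightBound_mono` BY NAME).  Road I's level ledgers and
road (δ)'s realized ledgers are both instances of this reading. [folklore] -/
theorem s_N21_of_slotLedgersReading {N : ℕ} [NeZero N] (SRec : SpineRecordPred N)
    (hread : ∀ (F : T4Continuum.T4Family) (D : YMDAG.UVSplit.Datum F N) (g₀ : ℕ → ℝ)
      (os : List (T4Continuum.ULoop F)) (S : SpineCarriers), SRec F D g₀ os S →
      ∃ (σA σB : Type) (SA : ℕ → Finset σA) (SB : ℕ → Finset σB) (pieceA : ℕ → ℝ → σA → S.ι → ℝ)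
        (pieceB : ℕ → ℝ → σB → S.ι → ℝ) (cA : ℕ → σA → ℝ) (cB : ℕ → σB → ℝ) (C ϑ : ℝ),
        SlotLedger S.l₀ S.T S.A S.shA SA pieceA cA ∧ SlotLedger S.l₀ S.T S.B S.shB SB pieceB cB ∧
        0 ≤ ϑ ∧ ϑ < 1 ∧ (∀ K, ∑ s ∈ SA K, cA K s ≤ C * ϑ ^ K) ∧ (∀ K, ∑ s ∈ SB K, cB K s ≤ C * ϑ ^ K) ∧
        (∀ K, ∑ s ∈ SA K, cA K s + ∑ s ∈ SB K, cB K s ≤ S.Wsh K) ∧ Summable S.Wsh) :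
    S_N21 SRec := by
  intro F D g₀ os S hS
  obtain ⟨σA, σB, SA, SB, pieceA, pieceB, cA, cB, C, ϑ, hA, hB, hϑ0, hϑ1, hωA, hωB, hWsh, hsum⟩ := hread F D g₀ os S hS
  exact shellWeightBound_mono (shellWeightBound_of_slotLedger hA hB hϑ0 hϑ1 hωA hωB) hWsh hsum

/-- **`S_N21` FOR EVERY ROAD-I READING.**  If the carrier predicate `SRec` hands, with every carrier bundle `S` it pins, road I's package —
slot types and data `(SA, pieceA, lvlA, DA, ρA)`, `(SB, pieceB, lvlB, DB, ρB)` with the two `LevelLedger`s at `(S.l₀, S.T, S.A, S.shA)`,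
`(S.l₀, S.T, S.B, S.shB)`, the two `LiveWindow`s with `(N₁, ν̄)`, `D ≤ D̄`, a rate `0 < ϑ < 1` with `ρ ≤ c₁ϑ^j` in both runs, and `S.Wsh`
summable and `≥ 2((N₁+1)ν̄D̄c₁ϑ^{−N₁})ϑ^K` — then `S_N21 SRec` (file 1's `n21_knit_levels` BY NAME). [folklore] -/
theorem s_N21_of_levelsReading {N : ℕ} [NeZero N] (SRec : SpineRecordPred N)
    (hread : ∀ (F : T4Continuum.T4Family) (D : YMDAG.UVSplit.Datum F N) (g₀ : ℕ → ℝ)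
      (os : List (T4Continuum.ULoop F)) (S : SpineCarriers), SRec F D g₀ os S →
      ∃ (σA σB : Type) (SA : ℕ → Finset σA) (SB : ℕ → Finset σB) (pieceA : ℕ → ℝ → σA → S.ι → ℝ)
        (pieceB : ℕ → ℝ → σB → S.ι → ℝ) (lvlA : ℕ → σA → ℕ) (lvlB : ℕ → σB → ℕ) (DA ρA DB ρB : ℕ → ℝ)
        (N₁ : ℕ) (νbar Dbar c₁ ϑ : ℝ),
        LevelLedger S.l₀ S.T S.A S.shA SA pieceA lvlA DA ρA ∧ LevelLedger S.l₀ S.T S.B S.shB SB pieceB lvlB DB ρB ∧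
        LiveWindow SA lvlA N₁ νbar ∧ LiveWindow SB lvlB N₁ νbar ∧ (∀ j, DA j ≤ Dbar) ∧ (∀ j, DB j ≤ Dbar) ∧
        0 < ϑ ∧ ϑ < 1 ∧ (∀ j, ρA j ≤ c₁ * ϑ ^ j) ∧ (∀ j, ρB j ≤ c₁ * ϑ ^ j) ∧
        (∀ K, (2 * ((N₁ + 1) * νbar * Dbar * c₁ * ϑ⁻¹ ^ N₁)) * ϑ ^ K ≤ S.Wsh K) ∧ Summable S.Wsh) :
    S_N21 SRec := by
  intro F D g₀ os S hS
  obtain ⟨σA, σB, SA, SB, pieceA, pieceB, lvlA, lvlB, DA, ρA, DB, ρB, N₁, νbar, Dbar, c₁, ϑ, hA, hB, hwA, hwB, hDA, hDB, hϑ0,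
    hϑ1, hrA, hrB, hWsh, hsum⟩ := hread F D g₀ os S hS
  exact n21_knit_levels hA hB hwA hwB hDA hDB hϑ0 hϑ1 hrA hrB hWsh hsum

/-- **`S_N21` FOR EVERY ROAD-II READING.**  If `SRec` hands, with every `S`, road II's package — a window `N`, slot counts `n`, slot
shell pieces `shAs`, `shBs`, common per-age ratios `x`, the two `AgeLedger`s at `(S.l₀, S.T, S.A)`, `(S.l₀, S.T, S.B)`, the shell parts
`0 ≤ S.shA ≤ S.A`, `0 ≤ S.shB ≤ S.B` covered by the slot pieces, a `LevelGain N x p y`, and `S.Wsh` summable and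
`≥ Σ_{a≤N} n_a e^{−pa} y(K − a)` — then `S_N21 SRec` (file 1's `n21_knit_ages_slot` BY NAME). [folklore] -/
theorem s_N21_of_agesReading {N : ℕ} [NeZero N] (SRec : SpineRecordPred N)
    (hread : ∀ (F : T4Continuum.T4Family) (D : YMDAG.UVSplit.Datum F N) (g₀ : ℕ → ℝ)
      (os : List (T4Continuum.ULoop F)) (S : SpineCarriers), SRec F D g₀ os S →
      ∃ (Nw : ℕ) (n : ℕ → ℕ) (shAs shBs : (Σ _ : ℕ, ℕ) → ℕ → ℝ → S.ι → ℝ) (x : ℕ → ℕ → ℝ) (p y : ℕ → ℝ),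
        AgeLedger S.l₀ S.T S.A Nw n shAs x ∧ AgeLedger S.l₀ S.T S.B Nw n shBs x ∧
        (∀ K t, |t| ≤ S.l₀ → ∀ τ ∈ S.T K, 0 ≤ S.shA K t τ) ∧ (∀ K t, |t| ≤ S.l₀ → ∀ τ ∈ S.T K, S.shA K t τ ≤ S.A K t τ) ∧
        (∀ K t, |t| ≤ S.l₀ → ∀ τ ∈ S.T K,
          S.shA K t τ ≤ ∑ σ ∈ (range (Nw + 1)).sigma (fun a => range (n a)), shAs σ K t τ) ∧
        (∀ K t, |t| ≤ S.l₀ → ∀ τ ∈ S.T K, 0 ≤ S.shB K t τ) ∧ (∀ K t, |t| ≤ S.l₀ → ∀ τ ∈ S.T K, S.shB K t τ ≤ S.B K t τ) ∧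
        (∀ K t, |t| ≤ S.l₀ → ∀ τ ∈ S.T K,
          S.shB K t τ ≤ ∑ σ ∈ (range (Nw + 1)).sigma (fun a => range (n a)), shBs σ K t τ) ∧
        LevelGain Nw x p y ∧
        (∀ K, ∑ a ∈ range (Nw + 1), (n a : ℝ) * (Real.exp (-p a) * y (K - a)) ≤ S.Wsh K) ∧ Summable S.Wsh) :
    S_N21 SRec := by
  intro F D g₀ os S hS
  obtain ⟨Nw, n, shAs, shBs, x, p, y, hLA, hLB, hA0, hAle, hAu, hB0, hBle, hBu, hg, hWsh, hsum⟩ := hread F D g₀ os S hS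
  exact n21_knit_ages_slot hLA hLB hA0 hAle hAu hB0 hBle hBu hg hWsh hsum

end Summit.QuantumFields.YangMills.Theorems.N21AtSpineCarriers

end
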